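/-
Copyright: the b2b-balaban T⁴-continuum CRUX team, row NE7b leaf lineage `t4-ne7b-formalise-leaf-04` (gen 156). Project licence.
-/
import Mathlib.Analysis.InnerProductSpace.Basic
import Mathlib.Order.Filter.Extr

/-!
# TWO AVERAGING SOFT STEPS ARE ONE AVERAGING SOFT STEP — THE INNER RESISTANCE IS DIVIDED BY THE BLOCK VOLUME:
# `min_z [α‖z − u‖² + β‖x − Q z‖²] = ν‖x − Q u‖²`, `ν⁻¹ = β⁻¹ + (αN)⁻¹`, for a blocking `Q` with `‖Qδ‖² ≤ N⁻¹‖δ‖²` and a block-constant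
# right inverse `S` (`QS = 1`, `‖Sθ‖² = N‖θ‖²`), attained at `z = u + S((β∕(αN+β))(x − Qu))`, the coarse average of ANY minimiser being the
# segment point `Qz = Qu + (β∕(αN+β))(x − Qu)`; hence for ANY action `f` and ANY inner window `K` an `(α, P)`-step followed by a
# `(β, Q)`-step IS the `(ν, Q ∘ P)`-step (same minimiser, same value, intermediate block field averaged onto the segment, both converses),
# and the letters `(N, S)` compose along a tower (row NE7b, node U5c; residual (R2′) family (2): the TOWER of soft averaging steps;
# [folklore] — the variational content of [B1] (2.12)–(2.16) «the composition of k successive renormalization transformations», Mathlib only)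

Cell `pub-balaban`, sub-cell `t4`, spine estimate NE7b (`T4WeightBudget.RelWeightBound`; the cell's OWN estimate — NOT PRINTED in
[Bałaban 1983–89], NOT PROVED).  Crux-route work under `Spine/NE7b/` by leaf-04 on the convexity road, in its own soft-step cell; NOTHING of
Bałaban's is named or asserted; no `T4Continuum/Support` leaf typed; no `def`; zero `sorry`.  Imports: Mathlib ONLY (fast lane; independent
of the `Spine/NE7b` olean frontier).  PRIOR ART IN THE TREE, located and NOT restated: this lineage's `…SoftStepSemigroup` (SSG, p384568 ✓:
the identity-blocking case `Q = 1`, `N = 1` — its declared NOT-HERE «the operator-`P` version … the mechanism of print's `a_k`» is THIS file;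
the pricing desk's F681 located «identity-section case; print's composition carries `Q`»); the tree's
`Literature.….BIJ85ScalarFormSemigroup` (§1 `oneStep_le` ∕ `oneStep_attained`: the kernel INEQUALITY of §1 below and its attainment as an
`∃`, in the letters `‖Qχ₀ − ψ‖`; §3 the semigroup of the QUADRATIC forms `Δ_k(u)` at every background — quadratic data only); leaf-03's
`…ConstrainedSchurTower` (two HARD eliminations are one, `⨅_{D₂v = w} ⨅_{D₁δ = v} = ⨅_{D₂D₁δ = w}`); this lineage's `…SoftConstraintEnvelope`
(SCE: the soft step is the Moreau envelope of the hard step) and `…AveragingFloorTower` (AFT: the FLOOR shadow of the law, `γ′⁻¹ ≤ a⁻¹ + q²γ⁻¹`,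
print's `a_k` = [B1] (2.13) BY NAME via `B1.aSeq_succ`).  NEW HERE: the kernel law WITH ITS REMAINDER (hence the located coarse average of
every minimiser), the composition at the level of an ARBITRARY `f` and inner window with a GENERAL inner blocking map `P` (not even linear),
both converses, and the composition of the blocking letters `(N, S)` themselves — so that the two-step theorem iterates along a tower of
averaging steps without re-deriving anything per level.

WHY.  The pricing desk's instruments (F686 kernel, F689 by value) show that a PER-STEP box of crude letters cannot be iterated at the
Gaussian fixed point: the box's letters multiply by ≥ 4 per step while the exact flow's growth factor tends to 1, and print's device is to
COMPOSE the steps — the quadratic form is carried in closed form and bounded once (F689 (5)).  The composition is a theorem about the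
exponent, valid for every action: a soft averaging step with penalty `α‖z − P y‖²` (new block field
`z`, blocking `P`) followed by one with penalty `β‖x − Q z‖²` is — after minimising over the intermediate block field `z` — the single soft
averaging step with blocking `Q ∘ P` and penalty weight `ν = αNβ∕(αN + β)`, i.e. `ν⁻¹ = β⁻¹ + (αN)⁻¹`: resistances in series add, the
inner one divided by the block volume `N` of the outer blocking (for plain block averages `N` = the number of fine points per block; in
variance currency `α = (2μ)⁻¹`, `β = (2λ)⁻¹` the composed parameter is `λ + μ∕N`; with King's ∕ [B1]'s rescaling this is the recursion
(2.13) for `a_k`).  So the background field of `k` successive soft averaging steps IS the one-big-step minimiser for the composite blocking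
and the composed weight, whose letters (MEL ∕ WME ∕ SCE ∕ this lineage's BPFF «one-big-step letter») are UNIFORM in `k` — no per-step loss.

WHAT IS PROVED ([folklore]: infimal postcomposition by a linear map commutes with infimal convolution by a quadratic — Bauschke–Combettes,
*Convex Analysis and Monotone Operator Theory* (2011) §12.5; Moreau 1965; the Gaussian-integral twin is [B1] T. Bałaban, Commun. Math. Phys.
**85** (1982) (2.12)–(2.16) — proved here from one polarisation identity, nothing cited as a fact).  `F`, `G` real inner product spaces,
`Q : F →ₗ[ℝ] G`, `S : G → F`, `N, α, β > 0`, `ν := αNβ∕(αN+β)`, `τ := β∕(αN+β)`; in §2 `E` is ANY type, `f : E → ℝ`, `K ⊆ E`, `P : E → F` ANY map,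
`q : F → E` a selection; every functional WRITTEN OUT.
* §1 THE KERNEL WITH BLOCKING: `resistor_identity` (`A‖w‖² + B‖v − w‖² = (AB∕(A+B))‖v‖² + (A+B)‖w − (B∕(A+B))•v‖²`),
  **`kernel_blocking_ge`** (`ν‖x − Qu‖² + (αN+β)‖Q(z − u) − τ•(x − Qu)‖² ≤ α‖z − u‖² + β‖x − Qz‖²` from `‖Qδ‖² ≤ N⁻¹‖δ‖²` alone),
  `kernel_blocking_le` (the `ν`-kernel is a lower bound — BIJ85's `oneStep_le` in this file's letters), **`kernel_blocking_attained`** (equality at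
  the EXPLICIT block field `z = u + S(τ•(x − Qu))`, from `QS = 1`, `‖Sθ‖² = N‖θ‖²`), `isMinOn_kernel_blocking` (that `z` minimises),
  **`avg_eq_of_kernel_min`** (ANY `z` reaching the `ν`-value has coarse average `Qz = Qu + τ•(x − Qu)` — the segment point of `[Qu, x]`).
* §2 TWO AVERAGING STEPS = ONE, ANY `f`, ANY INNER BLOCKING `P`, ANY INNER WINDOW `K`: `twoStep_ge_oneStep`; **`isMinOn_oneStep_of_twoStep`** (a
  selection `q` of inner `(α, P)`-step minimisers on `K` + an outer minimiser `z⋆` of `z ↦ [f (q z) + α‖z − P (q z)‖²] + β‖x − Qz‖²` ⟹ `q z⋆`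
  minimises `y ↦ f y + ν‖x − Q(P y)‖²` on `K`); **`twoStep_value_eq`** (the values agree); **`intermediate_avg_eq_of_twoStep`**
  (`Q z⋆ = Q(P(q z⋆)) + τ•(x − Q(P(q z⋆)))`); conversely **`isMinOn_innerStep_of_oneStep`** (a one-step minimiser `y⋆` minimises the inner step at
  `z⋆ := P y⋆ + S(τ•(x − Q(P y⋆)))`) and **`isMinOn_outerStep_of_oneStep`** (that `z⋆` minimises the outer step of the inner envelope, any `q`).
* §3 THE LETTERS COMPOSE ALONG A TOWER and THE PARAMETER ALGEBRA: `blocking_normSq_le_comp` (`‖Q₂Q₁δ‖² ≤ (N₁N₂)⁻¹‖δ‖²`),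
  `blocking_rightInverse_comp` (`Q₂Q₁S₁S₂ = 1`), `blocking_normSq_eq_comp` (`‖S₁S₂θ‖² = N₁N₂‖θ‖²`) — so §1–§2 apply verbatim to
  `Q₂ ∘ₗ Q₁`; `nu_pos`, **`nu_inv`** (`ν⁻¹ = β⁻¹ + (αN)⁻¹`), `nu_assoc` (three steps compose either way to the same weight — the semigroup
  law of the parameters), `nu_variance_currency` (`α = (2μ)⁻¹, β = (2λ)⁻¹ ⟹ ν = (2(λ + μ∕N))⁻¹`), `nu_identity_blocking` (`N = 1`: SSG's `λ + μ`).
* §4 toys (kernel `example`s): the identity blocking on `ℝ` inhabits the letters with `N = 1`; two unit steps `α = β = 1` through a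
  blocking of volume `N = 16` (`L = 2`, `d = 4`) compose to `ν = 16∕17`, `ν⁻¹ = 1 + 1∕16`.  (Non-trivial inhabitants of the letters
  `‖Qδ‖² ≤ N⁻¹‖δ‖²`, `QS = 1`, `‖Sθ‖² = N‖θ‖²`: leaf-01's `…TwoScalePoincareBlocking.blockAverage_normSq_le ∕ blockConstant_normSq_eq`
  (plain block averages, `N` = fibre size) and the tree's `BIJ85FluctuationCovarianceFlatBounds.norm_Qlin_sq_le` ∕ `BIJ85ScalarFormSemigroup.norm_qCovStar_sq`
  (covariant averages, `N = L^d`) — BY NAME, not imported.)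

NOT HERE (honest): the identity of quadratic FORMS (BIJ85 §3, by name — not imported, not restated); the hard tower (leaf-03's
`…ConstrainedSchurTower`) and the soft = envelope-of-hard dictionary (SCE) — with them this file closes the square hard∘hard ∕ soft∘soft ∕
soft = env(hard); UNIQUENESS of the intermediate block field itself (only its coarse average is located: the fluctuation part `z − u − S(…)`
is free in `ker Q ∩ {‖Qδ‖² = N⁻¹‖δ‖²}`-directions unless the equality case of the blocking letter is a hypothesis); windows on the
intermediate field; existence of outer minimisers (displayed); the rescaling that turns `λ + μ∕N` into [B1] (2.13) (AFT ∕ `B1.aSeq` carry it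
by name); which steps of print are soft averaging steps in which chart ((A3) ∕ (A1c), NC-NE7b-α UNRULED); anything of Bałaban's.
BY-NAME EFFECT ON THE WALL: NONE.  NE7b NOT PRINTED ∕ NOT PROVED; spine PROVED 0∕9; rung (B)+1 on a FINITE torus — NOT infinite volume, NOT
the mass gap, NOT Clay.  HONEST DEPENDENCY: continuum YM on T⁴ ⇐ BetaPertH ∧ nine spine estimates (0/9 proved); BetaPertH ⇐ (D1) ∧ (D4) ∧
CAP+tail; G-an2-4 gates asym, D1 and NE2∕3∕4.
-/

set_option autoImplicit false

namespace Summit.QuantumFields.BalabanUV.T4Continuum.NE7b.SoftStepBlockingSemigroup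

open Set
open scoped RealInnerProductSpace

variable {F G : Type*} [NormedAddCommGroup F] [InnerProductSpace ℝ F] [NormedAddCommGroup G] [InnerProductSpace ℝ G]
variable {Q : F →ₗ[ℝ] G} {S : G → F} {N α β : ℝ}

/-! ## §1 The kernel with blocking: resistances in series add, the inner one divided by the block volume -/

/-- **THE RESISTOR IDENTITY** (one polarisation): for `A + B ≠ 0`,
`A‖w‖² + B‖v − w‖² = (AB∕(A+B))‖v‖² + (A+B)‖w − (B∕(A+B))•v‖²`. [folklore] -/
theorem resistor_identity {A B : ℝ} (hAB : A + B ≠ 0) (v w : G) :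
    A * ‖w‖ ^ 2 + B * ‖v - w‖ ^ 2 = A * B / (A + B) * ‖v‖ ^ 2 + (A + B) * ‖w - (B / (A + B)) • v‖ ^ 2 := by
  rw [norm_sub_sq_real v w, norm_sub_sq_real w ((B / (A + B)) • v), real_inner_smul_right, norm_smul, Real.norm_eq_abs, mul_pow,
    sq_abs, real_inner_comm v w]
  field_simp
  ring

/-- **THE KERNEL WITH BLOCKING, LOWER BOUND WITH REMAINDER**: if `‖Qδ‖² ≤ N⁻¹‖δ‖²` (`N > 0`) and `α, β > 0`, then for all `u z x`
`ν‖x − Qu‖² + (αN+β)‖Q(z − u) − (β∕(αN+β))•(x − Qu)‖² ≤ α‖z − u‖² + β‖x − Qz‖²`, `ν = αNβ∕(αN+β)`. [folklore] -/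
theorem kernel_blocking_ge (hN : 0 < N) (hQ : ∀ δ, ‖Q δ‖ ^ 2 ≤ N⁻¹ * ‖δ‖ ^ 2) (hα : 0 < α) (hβ : 0 < β) (u z : F) (x : G) :
    α * N * β / (α * N + β) * ‖x - Q u‖ ^ 2 + (α * N + β) * ‖Q (z - u) - (β / (α * N + β)) • (x - Q u)‖ ^ 2 ≤
      α * ‖z - u‖ ^ 2 + β * ‖x - Q z‖ ^ 2 := by
  have hAB : α * N + β ≠ 0 := by positivity
  have h1 : α * N * ‖Q (z - u)‖ ^ 2 ≤ α * ‖z - u‖ ^ 2 := by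
    have h := mul_le_mul_of_nonneg_left (hQ (z - u)) (mul_pos hα hN).le
    calc α * N * ‖Q (z - u)‖ ^ 2 ≤ α * N * (N⁻¹ * ‖z - u‖ ^ 2) := h
      _ = α * ‖z - u‖ ^ 2 := by field_simp
  have h2 := resistor_identity hAB (x - Q u) (Q (z - u))
  have h3 : (x - Q u) - Q (z - u) = x - Q z := by rw [map_sub]; abel
  rw [h3] at h2
  linarith

/-- **THE `ν`-KERNEL IS A LOWER BOUND**: `ν‖x − Qu‖² ≤ α‖z − u‖² + β‖x − Qz‖²` for every intermediate block field `z` (the content of the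
tree's `BIJ85ScalarFormSemigroup.oneStep_le`, in this file's letters). [folklore] -/
theorem kernel_blocking_le (hN : 0 < N) (hQ : ∀ δ, ‖Q δ‖ ^ 2 ≤ N⁻¹ * ‖δ‖ ^ 2) (hα : 0 < α) (hβ : 0 < β) (u z : F) (x : G) :
    α * N * β / (α * N + β) * ‖x - Q u‖ ^ 2 ≤ α * ‖z - u‖ ^ 2 + β * ‖x - Q z‖ ^ 2 := by
  have h := kernel_blocking_ge hN hQ hα hβ u z x
  have : 0 ≤ (α * N + β) * ‖Q (z - u) - (β / (α * N + β)) • (x - Q u)‖ ^ 2 := by positivity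
  linarith

/-- **THE MINIMUM IS ATTAINED AT THE EXPLICIT BLOCK FIELD** `z = u + S((β∕(αN+β))•(x − Qu))` (`QS = 1`, `‖Sθ‖² = N‖θ‖²`):
`α‖z − u‖² + β‖x − Qz‖² = ν‖x − Qu‖²`. [folklore] -/
theorem kernel_blocking_attained (hN : 0 < N) (hS : ∀ θ, Q (S θ) = θ) (hSn : ∀ θ, ‖S θ‖ ^ 2 = N * ‖θ‖ ^ 2) (hα : 0 < α) (hβ : 0 < β)
    (u : F) (x : G) :
    α * ‖(u + S ((β / (α * N + β)) • (x - Q u))) - u‖ ^ 2 + β * ‖x - Q (u + S ((β / (α * N + β)) • (x - Q u)))‖ ^ 2 =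
      α * N * β / (α * N + β) * ‖x - Q u‖ ^ 2 := by
  have hAB : α * N + β ≠ 0 := by positivity
  have e1 : x - (Q u + (β / (α * N + β)) • (x - Q u)) = (α * N / (α * N + β)) • (x - Q u) := by
    rw [show x - (Q u + (β / (α * N + β)) • (x - Q u)) = (x - Q u) - (β / (α * N + β)) • (x - Q u) by abel,
      show (x - Q u) - (β / (α * N + β)) • (x - Q u) = (1 - β / (α * N + β)) • (x - Q u) by rw [sub_smul, one_smul]]
    congr 1
    field_simp
    ring
  rw [add_sub_cancel_left, hSn, map_add, hS, e1, norm_smul, norm_smul, Real.norm_eq_abs, Real.norm_eq_abs, mul_pow, mul_pow, sq_abs,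
    sq_abs]
  field_simp
  ring

/-- **THAT BLOCK FIELD MINIMISES THE KERNEL** over all intermediate fields. [folklore] -/
theorem isMinOn_kernel_blocking (hN : 0 < N) (hQ : ∀ δ, ‖Q δ‖ ^ 2 ≤ N⁻¹ * ‖δ‖ ^ 2) (hS : ∀ θ, Q (S θ) = θ)
    (hSn : ∀ θ, ‖S θ‖ ^ 2 = N * ‖θ‖ ^ 2) (hα : 0 < α) (hβ : 0 < β) (u : F) (x : G) :
    IsMinOn (fun z => α * ‖z - u‖ ^ 2 + β * ‖x - Q z‖ ^ 2) univ (u + S ((β / (α * N + β)) • (x - Q u))) := by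
  intro z _
  show α * ‖(u + S ((β / (α * N + β)) • (x - Q u))) - u‖ ^ 2 + β * ‖x - Q (u + S ((β / (α * N + β)) • (x - Q u)))‖ ^ 2 ≤
    α * ‖z - u‖ ^ 2 + β * ‖x - Q z‖ ^ 2
  rw [kernel_blocking_attained hN hS hSn hα hβ u x]
  exact kernel_blocking_le hN hQ hα hβ u z x

/-- **THE COARSE AVERAGE OF EVERY MINIMISER IS THE SEGMENT POINT**: if `z` reaches the `ν`-value,
`α‖z − u‖² + β‖x − Qz‖² ≤ ν‖x − Qu‖²`, then `Qz = Qu + (β∕(αN+β))•(x − Qu)` (the remainder of `kernel_blocking_ge` vanishes). Only the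
average is located: the fine part of `z − u` in `ker Q` is constrained by the blocking letter's equality case, not here. [folklore] -/
theorem avg_eq_of_kernel_min (hN : 0 < N) (hQ : ∀ δ, ‖Q δ‖ ^ 2 ≤ N⁻¹ * ‖δ‖ ^ 2) (hα : 0 < α) (hβ : 0 < β) {u z : F} {x : G}
    (hmin : α * ‖z - u‖ ^ 2 + β * ‖x - Q z‖ ^ 2 ≤ α * N * β / (α * N + β) * ‖x - Q u‖ ^ 2) :
    Q z = Q u + (β / (α * N + β)) • (x - Q u) := by
  have h := kernel_blocking_ge hN hQ hα hβ u z x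
  have hc : 0 < α * N + β := by positivity
  have h0 : (α * N + β) * ‖Q (z - u) - (β / (α * N + β)) • (x - Q u)‖ ^ 2 = 0 :=
    le_antisymm (by linarith) (by positivity)
  rcases mul_eq_zero.1 h0 with h1 | h1
  · exact absurd h1 hc.ne'
  · rw [sq_eq_zero_iff, norm_eq_zero, sub_eq_zero, map_sub] at h1
    rw [← h1, add_sub_cancel]

/-! ## §2 Two averaging soft steps are one — any `f`, any inner blocking map `P`, any inner window `K` -/

section TwoSteps

variable {E : Type*} {f : E → ℝ} {K : Set E} {P : E → F} {q : F → E} {x : G}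

/-- **THE JOINT TWO-STEP FUNCTIONAL DOMINATES THE ONE-STEP FUNCTIONAL**:
`f y + ν‖x − Q(P y)‖² ≤ f y + α‖z − P y‖² + β‖x − Qz‖²`, equality at §1's block field. [folklore] -/
theorem twoStep_ge_oneStep (hN : 0 < N) (hQ : ∀ δ, ‖Q δ‖ ^ 2 ≤ N⁻¹ * ‖δ‖ ^ 2) (hα : 0 < α) (hβ : 0 < β) (f : E → ℝ) (P : E → F)
    (x : G) (y : E) (z : F) :
    f y + α * N * β / (α * N + β) * ‖x - Q (P y)‖ ^ 2 ≤ f y + α * ‖z - P y‖ ^ 2 + β * ‖x - Q z‖ ^ 2 := by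
  have := kernel_blocking_le hN hQ hα hβ (P y) z x
  linarith

/-- **AN `(α, P)`-STEP THEN A `(β, Q)`-STEP IS THE `(ν, Q ∘ P)`-STEP — THE MINIMISER.**  Let `q` select inner-step minimisers on the
window `K` (`IsMinOn (y ↦ f y + α‖z − P y‖²) K (q z)` for every block field `z`) and let `z⋆` minimise the outer step of the inner envelope,
`z ↦ [f (q z) + α‖z − P (q z)‖²] + β‖x − Qz‖²`, over `F`.  Then `q z⋆` minimises the composite step `y ↦ f y + ν‖x − Q(P y)‖²` on `K`.
No convexity, no linearity of `P`, no dimension. [folklore] -/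
theorem isMinOn_oneStep_of_twoStep (hN : 0 < N) (hQ : ∀ δ, ‖Q δ‖ ^ 2 ≤ N⁻¹ * ‖δ‖ ^ 2) (hS : ∀ θ, Q (S θ) = θ)
    (hSn : ∀ θ, ‖S θ‖ ^ 2 = N * ‖θ‖ ^ 2) (hα : 0 < α) (hβ : 0 < β)
    (hq : ∀ z, IsMinOn (fun y => f y + α * ‖z - P y‖ ^ 2) K (q z)) {zs : F}
    (hzs : IsMinOn (fun z => (f (q z) + α * ‖z - P (q z)‖ ^ 2) + β * ‖x - Q z‖ ^ 2) univ zs) :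
    IsMinOn (fun y => f y + α * N * β / (α * N + β) * ‖x - Q (P y)‖ ^ 2) K (q zs) := by
  intro y hy
  -- one(q z⋆) ≤ outer(z⋆) ≤ outer(ẑ) ≤ f y + kernel(ẑ) = one(y), with ẑ the explicit block field over the centre `P y`
  have h1 := kernel_blocking_attained hN hS hSn hα hβ (P y) x
  have h2 : f (q (P y + S ((β / (α * N + β)) • (x - Q (P y))))) +
        α * ‖(P y + S ((β / (α * N + β)) • (x - Q (P y)))) - P (q (P y + S ((β / (α * N + β)) • (x - Q (P y)))))‖ ^ 2
      ≤ f y + α * ‖(P y + S ((β / (α * N + β)) • (x - Q (P y)))) - P y‖ ^ 2 := hq _ hy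
  have h3 : (f (q zs) + α * ‖zs - P (q zs)‖ ^ 2) + β * ‖x - Q zs‖ ^ 2 ≤
      (f (q (P y + S ((β / (α * N + β)) • (x - Q (P y))))) +
          α * ‖(P y + S ((β / (α * N + β)) • (x - Q (P y)))) - P (q (P y + S ((β / (α * N + β)) • (x - Q (P y)))))‖ ^ 2)
        + β * ‖x - Q (P y + S ((β / (α * N + β)) • (x - Q (P y))))‖ ^ 2 := hzs (mem_univ _)
  have h4 := twoStep_ge_oneStep hN hQ hα hβ f P x (q zs) zs
  show f (q zs) + α * N * β / (α * N + β) * ‖x - Q (P (q zs))‖ ^ 2 ≤ f y + α * N * β / (α * N + β) * ‖x - Q (P y)‖ ^ 2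
  linarith

/-- **THE VALUES AGREE**: the outer minimum of the inner envelope's `(β, Q)`-step equals the composite `(ν, Q ∘ P)`-step value at `q z⋆`
(the variational `e^{Q}_β(e^{P}_α f)(x) = e^{Q∘P}_ν f(x)` at the minimisers). [folklore] -/
theorem twoStep_value_eq (hN : 0 < N) (hQ : ∀ δ, ‖Q δ‖ ^ 2 ≤ N⁻¹ * ‖δ‖ ^ 2) (hS : ∀ θ, Q (S θ) = θ)
    (hSn : ∀ θ, ‖S θ‖ ^ 2 = N * ‖θ‖ ^ 2) (hα : 0 < α) (hβ : 0 < β) (hqK : ∀ z, q z ∈ K)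
    (hq : ∀ z, IsMinOn (fun y => f y + α * ‖z - P y‖ ^ 2) K (q z)) {zs : F}
    (hzs : IsMinOn (fun z => (f (q z) + α * ‖z - P (q z)‖ ^ 2) + β * ‖x - Q z‖ ^ 2) univ zs) :
    (f (q zs) + α * ‖zs - P (q zs)‖ ^ 2) + β * ‖x - Q zs‖ ^ 2 = f (q zs) + α * N * β / (α * N + β) * ‖x - Q (P (q zs))‖ ^ 2 := by
  have h1 := kernel_blocking_attained hN hS hSn hα hβ (P (q zs)) x
  have h2 : f (q (P (q zs) + S ((β / (α * N + β)) • (x - Q (P (q zs)))))) +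
        α * ‖(P (q zs) + S ((β / (α * N + β)) • (x - Q (P (q zs))))) -
          P (q (P (q zs) + S ((β / (α * N + β)) • (x - Q (P (q zs))))))‖ ^ 2
      ≤ f (q zs) + α * ‖(P (q zs) + S ((β / (α * N + β)) • (x - Q (P (q zs))))) - P (q zs)‖ ^ 2 := hq _ (hqK zs)
  have h3 : (f (q zs) + α * ‖zs - P (q zs)‖ ^ 2) + β * ‖x - Q zs‖ ^ 2 ≤
      (f (q (P (q zs) + S ((β / (α * N + β)) • (x - Q (P (q zs)))))) +
          α * ‖(P (q zs) + S ((β / (α * N + β)) • (x - Q (P (q zs))))) -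
            P (q (P (q zs) + S ((β / (α * N + β)) • (x - Q (P (q zs))))))‖ ^ 2)
        + β * ‖x - Q (P (q zs) + S ((β / (α * N + β)) • (x - Q (P (q zs)))))‖ ^ 2 := hzs (mem_univ _)
  have h4 := twoStep_ge_oneStep hN hQ hα hβ f P x (q zs) zs
  linarith

/-- **THE INTERMEDIATE BLOCK FIELD IS AVERAGED ONTO THE SEGMENT**: `Q z⋆ = Q(P(q z⋆)) + (β∕(αN+β))•(x − Q(P(q z⋆)))` — the outer
minimiser's coarse average is the point of `[Q(P(q z⋆)), x]` at parameter `β∕(αN+β)` (§1's located average). [folklore] -/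
theorem intermediate_avg_eq_of_twoStep (hN : 0 < N) (hQ : ∀ δ, ‖Q δ‖ ^ 2 ≤ N⁻¹ * ‖δ‖ ^ 2) (hS : ∀ θ, Q (S θ) = θ)
    (hSn : ∀ θ, ‖S θ‖ ^ 2 = N * ‖θ‖ ^ 2) (hα : 0 < α) (hβ : 0 < β) (hqK : ∀ z, q z ∈ K)
    (hq : ∀ z, IsMinOn (fun y => f y + α * ‖z - P y‖ ^ 2) K (q z)) {zs : F}
    (hzs : IsMinOn (fun z => (f (q z) + α * ‖z - P (q z)‖ ^ 2) + β * ‖x - Q z‖ ^ 2) univ zs) :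
    Q zs = Q (P (q zs)) + (β / (α * N + β)) • (x - Q (P (q zs))) := by
  have hv := twoStep_value_eq hN hQ hS hSn hα hβ hqK hq hzs
  exact avg_eq_of_kernel_min hN hQ hα hβ (by linarith)

/-- **CONVERSELY, FROM A COMPOSITE-STEP MINIMISER — THE INNER STEP**: if `y⋆` minimises `y ↦ f y + ν‖x − Q(P y)‖²` on `K`, then `y⋆`
minimises the inner step `y ↦ f y + α‖z⋆ − P y‖²` on `K` at the block field `z⋆ := P y⋆ + S((β∕(αN+β))•(x − Q(P y⋆)))`. [folklore] -/
theorem isMinOn_innerStep_of_oneStep (hN : 0 < N) (hQ : ∀ δ, ‖Q δ‖ ^ 2 ≤ N⁻¹ * ‖δ‖ ^ 2) (hS : ∀ θ, Q (S θ) = θ)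
    (hSn : ∀ θ, ‖S θ‖ ^ 2 = N * ‖θ‖ ^ 2) (hα : 0 < α) (hβ : 0 < β) {ys : E}
    (hmin : IsMinOn (fun y => f y + α * N * β / (α * N + β) * ‖x - Q (P y)‖ ^ 2) K ys) :
    IsMinOn (fun y => f y + α * ‖(P ys + S ((β / (α * N + β)) • (x - Q (P ys)))) - P y‖ ^ 2) K ys := by
  intro y hy
  -- inner(y⋆) + β‖x − Q z⋆‖² = one(y⋆) ≤ one(y) ≤ inner(y) + β‖x − Q z⋆‖²
  have h1 := kernel_blocking_attained hN hS hSn hα hβ (P ys) x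
  have h2 : f ys + α * N * β / (α * N + β) * ‖x - Q (P ys)‖ ^ 2 ≤ f y + α * N * β / (α * N + β) * ‖x - Q (P y)‖ ^ 2 := hmin hy
  have h3 := twoStep_ge_oneStep hN hQ hα hβ f P x y (P ys + S ((β / (α * N + β)) • (x - Q (P ys))))
  show f ys + α * ‖(P ys + S ((β / (α * N + β)) • (x - Q (P ys)))) - P ys‖ ^ 2 ≤
    f y + α * ‖(P ys + S ((β / (α * N + β)) • (x - Q (P ys)))) - P y‖ ^ 2
  linarith

/-- **CONVERSELY — THE OUTER STEP**: with `y⋆ ∈ K` a composite-step minimiser, `z⋆` its block field and ANY selection `q` of inner-step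
minimisers on `K`, `z⋆` minimises the outer `(β, Q)`-step of the inner envelope over `F`. [folklore] -/
theorem isMinOn_outerStep_of_oneStep (hN : 0 < N) (hQ : ∀ δ, ‖Q δ‖ ^ 2 ≤ N⁻¹ * ‖δ‖ ^ 2) (hS : ∀ θ, Q (S θ) = θ)
    (hSn : ∀ θ, ‖S θ‖ ^ 2 = N * ‖θ‖ ^ 2) (hα : 0 < α) (hβ : 0 < β) (hqK : ∀ z, q z ∈ K)
    (hq : ∀ z, IsMinOn (fun y => f y + α * ‖z - P y‖ ^ 2) K (q z)) {ys : E} (hys : ys ∈ K)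
    (hmin : IsMinOn (fun y => f y + α * N * β / (α * N + β) * ‖x - Q (P y)‖ ^ 2) K ys) :
    IsMinOn (fun z => (f (q z) + α * ‖z - P (q z)‖ ^ 2) + β * ‖x - Q z‖ ^ 2) univ
      (P ys + S ((β / (α * N + β)) • (x - Q (P ys)))) := by
  intro z _
  -- outer(z⋆) ≤ f y⋆ + kernel(z⋆) = one(y⋆) ≤ one(q z) ≤ outer(z)
  have h1 : f (q (P ys + S ((β / (α * N + β)) • (x - Q (P ys))))) +
        α * ‖(P ys + S ((β / (α * N + β)) • (x - Q (P ys)))) - P (q (P ys + S ((β / (α * N + β)) • (x - Q (P ys)))))‖ ^ 2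
      ≤ f ys + α * ‖(P ys + S ((β / (α * N + β)) • (x - Q (P ys)))) - P ys‖ ^ 2 := hq _ hys
  have h2 := kernel_blocking_attained hN hS hSn hα hβ (P ys) x
  have h3 : f ys + α * N * β / (α * N + β) * ‖x - Q (P ys)‖ ^ 2 ≤
      f (q z) + α * N * β / (α * N + β) * ‖x - Q (P (q z))‖ ^ 2 := hmin (hqK z)
  have h4 := twoStep_ge_oneStep hN hQ hα hβ f P x (q z) z
  show (f (q (P ys + S ((β / (α * N + β)) • (x - Q (P ys))))) +
        α * ‖(P ys + S ((β / (α * N + β)) • (x - Q (P ys)))) - P (q (P ys + S ((β / (α * N + β)) • (x - Q (P ys)))))‖ ^ 2)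
      + β * ‖x - Q (P ys + S ((β / (α * N + β)) • (x - Q (P ys))))‖ ^ 2
    ≤ (f (q z) + α * ‖z - P (q z)‖ ^ 2) + β * ‖x - Q z‖ ^ 2
  linarith

end TwoSteps

/-! ## §3 The blocking letters compose along a tower; the parameter algebra -/

section Tower

variable {E : Type*} [NormedAddCommGroup E] [InnerProductSpace ℝ E]
variable {Q₁ : E →ₗ[ℝ] F} {Q₂ : F →ₗ[ℝ] G} {S₁ : F → E} {S₂ : G → F} {N₁ N₂ : ℝ}

/-- **THE BLOCKING LETTER COMPOSES**: `‖Q₁δ‖² ≤ N₁⁻¹‖δ‖²`, `‖Q₂ε‖² ≤ N₂⁻¹‖ε‖²` (`N₂ > 0`) ⟹ `‖Q₂(Q₁δ)‖² ≤ (N₁N₂)⁻¹‖δ‖²`. [folklore] -/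
theorem blocking_normSq_le_comp (hN₂ : 0 < N₂) (hQ₁ : ∀ δ, ‖Q₁ δ‖ ^ 2 ≤ N₁⁻¹ * ‖δ‖ ^ 2)
    (hQ₂ : ∀ ε, ‖Q₂ ε‖ ^ 2 ≤ N₂⁻¹ * ‖ε‖ ^ 2) (δ : E) : ‖(Q₂ ∘ₗ Q₁) δ‖ ^ 2 ≤ (N₁ * N₂)⁻¹ * ‖δ‖ ^ 2 := by
  rw [LinearMap.comp_apply]
  calc ‖Q₂ (Q₁ δ)‖ ^ 2 ≤ N₂⁻¹ * ‖Q₁ δ‖ ^ 2 := hQ₂ _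
    _ ≤ N₂⁻¹ * (N₁⁻¹ * ‖δ‖ ^ 2) := mul_le_mul_of_nonneg_left (hQ₁ δ) (inv_pos.mpr hN₂).le
    _ = (N₁ * N₂)⁻¹ * ‖δ‖ ^ 2 := by rw [mul_inv]; ring

/-- **THE BLOCK-CONSTANT EXTENSIONS COMPOSE** (right inverses): `Q₁S₁ = 1`, `Q₂S₂ = 1` ⟹ `(Q₂Q₁)(S₁S₂) = 1`. [folklore] -/
theorem blocking_rightInverse_comp (hS₁ : ∀ φ, Q₁ (S₁ φ) = φ) (hS₂ : ∀ θ, Q₂ (S₂ θ) = θ) (θ : G) :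
    (Q₂ ∘ₗ Q₁) ((S₁ ∘ S₂) θ) = θ := by
  rw [LinearMap.comp_apply, Function.comp_apply, hS₁, hS₂]

omit [InnerProductSpace ℝ F] [InnerProductSpace ℝ G] [InnerProductSpace ℝ E] in
/-- **THEIR NORM LETTERS MULTIPLY**: `‖S₁φ‖² = N₁‖φ‖²`, `‖S₂θ‖² = N₂‖θ‖²` ⟹ `‖S₁(S₂θ)‖² = N₁N₂‖θ‖²`. [folklore] -/
theorem blocking_normSq_eq_comp (hS₁n : ∀ φ, ‖S₁ φ‖ ^ 2 = N₁ * ‖φ‖ ^ 2) (hS₂n : ∀ θ, ‖S₂ θ‖ ^ 2 = N₂ * ‖θ‖ ^ 2) (θ : G) :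
    ‖(S₁ ∘ S₂) θ‖ ^ 2 = N₁ * N₂ * ‖θ‖ ^ 2 := by
  rw [Function.comp_apply, hS₁n, hS₂n, mul_assoc]

end Tower

section Parameters

/-- The composed weight is positive. [folklore] -/
theorem nu_pos (hN : 0 < N) (hα : 0 < α) (hβ : 0 < β) : 0 < α * N * β / (α * N + β) := by positivity

/-- **RESISTANCES ADD, THE INNER ONE DIVIDED BY THE BLOCK VOLUME**: `ν⁻¹ = β⁻¹ + (αN)⁻¹`. [folklore] -/
theorem nu_inv (hN : 0 < N) (hα : 0 < α) (hβ : 0 < β) : (α * N * β / (α * N + β))⁻¹ = β⁻¹ + (α * N)⁻¹ := by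
  have hαN : α * N ≠ 0 := by positivity
  field_simp

/-- **THE PARAMETERS FORM A SEMIGROUP** (three steps compose either way): composing `(α, N₂)` with `β` and then the result, through a
blocking of volume `N₃`, with `γ` gives the same weight as composing `α` through the composite blocking (volume `N₂N₃`) with the
composition of `(β, N₃)` and `γ` — both equal to `(γ⁻¹ + (βN₃)⁻¹ + (αN₂N₃)⁻¹)⁻¹`. [folklore] -/
theorem nu_assoc {N₂ N₃ γ : ℝ} (hN₂ : 0 < N₂) (hN₃ : 0 < N₃) (hα : 0 < α) (hβ : 0 < β) (hγ : 0 < γ) :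
    (α * N₂ * β / (α * N₂ + β)) * N₃ * γ / ((α * N₂ * β / (α * N₂ + β)) * N₃ + γ) =
      α * (N₂ * N₃) * (β * N₃ * γ / (β * N₃ + γ)) / (α * (N₂ * N₃) + β * N₃ * γ / (β * N₃ + γ)) := by
  have h1 : α * N₂ + β ≠ 0 := by positivity
  have h2 : β * N₃ + γ ≠ 0 := by positivity
  have h3 : (α * N₂ * β / (α * N₂ + β)) * N₃ + γ ≠ 0 := by positivity
  have h4 : α * (N₂ * N₃) + β * N₃ * γ / (β * N₃ + γ) ≠ 0 := by positivity
  field_simp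
  ring

/-- The common value of `nu_assoc` in resistor form: `(γ⁻¹ + (βN₃)⁻¹ + (αN₂N₃)⁻¹)⁻¹`. [folklore] -/
theorem nu_three_inv {N₂ N₃ γ : ℝ} (hN₂ : 0 < N₂) (hN₃ : 0 < N₃) (hα : 0 < α) (hβ : 0 < β) (hγ : 0 < γ) :
    ((α * N₂ * β / (α * N₂ + β)) * N₃ * γ / ((α * N₂ * β / (α * N₂ + β)) * N₃ + γ))⁻¹ = γ⁻¹ + (β * N₃)⁻¹ + (α * N₂ * N₃)⁻¹ := by
  rw [nu_inv hN₃ (nu_pos hN₂ hα hβ) hγ, mul_comm (α * N₂ * β / (α * N₂ + β)) N₃, ← mul_comm (α * N₂ * β / (α * N₂ + β)) N₃, mul_inv,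
    nu_inv hN₂ hα hβ]
  have hN₃' : N₃ ≠ 0 := hN₃.ne'
  field_simp
  ring

/-- **VARIANCE CURRENCY** (SSG's letters): with `α = (2μ)⁻¹`, `β = (2λ)⁻¹` the composed weight is `(2(λ + μ∕N))⁻¹` — the inner parameter
`μ` is divided by the block volume. [folklore] -/
theorem nu_variance_currency {lam mu : ℝ} (hN : 0 < N) (hl : 0 < lam) (hm : 0 < mu) :
    (2 * mu)⁻¹ * N * (2 * lam)⁻¹ / ((2 * mu)⁻¹ * N + (2 * lam)⁻¹) = (2 * (lam + mu / N))⁻¹ := by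
  have h1 : (2 * mu)⁻¹ * N + (2 * lam)⁻¹ ≠ 0 := by positivity
  have h2 : 2 * (lam + mu / N) ≠ 0 := by positivity
  field_simp

/-- **IDENTITY BLOCKING** (`N = 1`): the composed weight is `αβ∕(α+β)`, i.e. in variance currency `λ + μ` — SSG's semigroup parameter.
[folklore] -/
theorem nu_identity_blocking (α β : ℝ) : α * 1 * β / (α * 1 + β) = α * β / (α + β) := by
  simp only [mul_one]

end Parameters

/-! ## §4 Toys (kernel checks of the shapes; no instance of print's) -/

/-- Toy: on `G = F = ℝ` with `Q = 1`, `S = 1`, `N = 1`, the blocking letters hold (`‖δ‖² ≤ 1⁻¹‖δ‖²`, `‖θ‖² = 1·‖θ‖²`). -/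
example : (∀ δ : ℝ, ‖(LinearMap.id : ℝ →ₗ[ℝ] ℝ) δ‖ ^ 2 ≤ (1 : ℝ)⁻¹ * ‖δ‖ ^ 2) ∧ (∀ θ : ℝ, ‖(id : ℝ → ℝ) θ‖ ^ 2 = 1 * ‖θ‖ ^ 2) :=
  ⟨fun δ => by simp, fun θ => by simp⟩

/-- Toy (King's two unit steps): `α = β = a`, block volume `N`: `ν = a²N∕(aN + a) = aN∕(N + 1)`; for `N = 16` (`L = 2`, `d = 4`), `a = 1`:
`ν = 16∕17`, and `ν⁻¹ = 1 + 1∕16`. -/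
example : (1 : ℝ) * 16 * 1 / (1 * 16 + 1) = 16 / 17 ∧ ((16 : ℝ) / 17)⁻¹ = 1 + 1 / 16 := by norm_num

/-! ## §5 (v1.1, append-only). UNIQUENESS of the intermediate block field under the blocking letter's EQUALITY CASE (v1's NOT-HERE):
if `‖Qδ‖² = N⁻¹‖δ‖²` only for block-constant `δ = S(Qδ)` (Jensen's equality case), every minimiser IS `u + S(τ•(x − Qu))` — SSG's
`intermediate_eq_of_twoStep` (`Q = S = 1`, `N = 1`, trivial equality-case letter) with blocking. -/
section EqualityCase

/-- **A MINIMISER SATURATES THE BLOCKING LETTER**: `z` reaching the `ν`-value has `‖Q(z − u)‖² = N⁻¹‖z − u‖²`. [folklore] -/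
theorem normSq_eq_of_kernel_min (hN : 0 < N) (hQ : ∀ δ, ‖Q δ‖ ^ 2 ≤ N⁻¹ * ‖δ‖ ^ 2) (hα : 0 < α) (hβ : 0 < β) {u z : F} {x : G}
    (hmin : α * ‖z - u‖ ^ 2 + β * ‖x - Q z‖ ^ 2 ≤ α * N * β / (α * N + β) * ‖x - Q u‖ ^ 2) :
    ‖Q (z - u)‖ ^ 2 = N⁻¹ * ‖z - u‖ ^ 2 := by
  have h1 : α * N * ‖Q (z - u)‖ ^ 2 ≤ α * ‖z - u‖ ^ 2 := by
    have h := mul_le_mul_of_nonneg_left (hQ (z - u)) (mul_pos hα hN).le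
    calc α * N * ‖Q (z - u)‖ ^ 2 ≤ α * N * (N⁻¹ * ‖z - u‖ ^ 2) := h
      _ = α * ‖z - u‖ ^ 2 := by field_simp
  have h2 := resistor_identity (by positivity : α * N + β ≠ 0) (x - Q u) (Q (z - u))
  have h3 : (x - Q u) - Q (z - u) = x - Q z := by rw [map_sub]; abel
  rw [h3] at h2
  have h4 : 0 ≤ (α * N + β) * ‖Q (z - u) - (β / (α * N + β)) • (x - Q u)‖ ^ 2 := by positivity
  have h5 : α * (N * ‖Q (z - u)‖ ^ 2) = α * ‖z - u‖ ^ 2 := by rw [← mul_assoc]; linarith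
  have h6 : N * ‖Q (z - u)‖ ^ 2 = ‖z - u‖ ^ 2 := mul_left_cancel₀ hα.ne' h5
  rw [← h6, ← mul_assoc, inv_mul_cancel₀ hN.ne', one_mul]
/-- **UNIQUENESS OF THE INTERMEDIATE BLOCK FIELD** under `‖Qδ‖² = N⁻¹‖δ‖² → δ = S(Qδ)`: `z = u + S((β∕(αN+β))•(x − Qu))`. [folklore] -/
theorem eq_of_kernel_min (hN : 0 < N) (hQ : ∀ δ, ‖Q δ‖ ^ 2 ≤ N⁻¹ * ‖δ‖ ^ 2)
    (hQeq : ∀ δ, ‖Q δ‖ ^ 2 = N⁻¹ * ‖δ‖ ^ 2 → δ = S (Q δ)) (hα : 0 < α) (hβ : 0 < β) {u z : F} {x : G}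
    (hmin : α * ‖z - u‖ ^ 2 + β * ‖x - Q z‖ ^ 2 ≤ α * N * β / (α * N + β) * ‖x - Q u‖ ^ 2) :
    z = u + S ((β / (α * N + β)) • (x - Q u)) := by
  have hδ : z - u = S (Q (z - u)) := hQeq _ (normSq_eq_of_kernel_min hN hQ hα hβ hmin)
  have havg : Q (z - u) = (β / (α * N + β)) • (x - Q u) := by
    rw [map_sub, avg_eq_of_kernel_min hN hQ hα hβ hmin, add_sub_cancel_left]
  rw [havg] at hδ; rw [← hδ, add_sub_cancel]
/-- **THE OUTER MINIMISER IS THE EXPLICIT BLOCK FIELD** (§2 upgraded): `z⋆ = P(q z⋆) + S((β∕(αN+β))•(x − Q(P(q z⋆))))`. [folklore] -/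
theorem intermediate_eq_of_twoStep {E : Type*} {f : E → ℝ} {K : Set E} {P : E → F} {q : F → E} {x : G} (hN : 0 < N)
    (hQ : ∀ δ, ‖Q δ‖ ^ 2 ≤ N⁻¹ * ‖δ‖ ^ 2) (hQeq : ∀ δ, ‖Q δ‖ ^ 2 = N⁻¹ * ‖δ‖ ^ 2 → δ = S (Q δ)) (hS : ∀ θ, Q (S θ) = θ)
    (hSn : ∀ θ, ‖S θ‖ ^ 2 = N * ‖θ‖ ^ 2) (hα : 0 < α) (hβ : 0 < β) (hqK : ∀ z, q z ∈ K)
    (hq : ∀ z, IsMinOn (fun y => f y + α * ‖z - P y‖ ^ 2) K (q z)) {zs : F}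
    (hzs : IsMinOn (fun z => (f (q z) + α * ‖z - P (q z)‖ ^ 2) + β * ‖x - Q z‖ ^ 2) univ zs) :
    zs = P (q zs) + S ((β / (α * N + β)) • (x - Q (P (q zs)))) := by
  have hv := twoStep_value_eq hN hQ hS hSn hα hβ hqK hq hzs
  exact eq_of_kernel_min hN hQ hQeq hα hβ (by linarith)

end EqualityCase

end Summit.QuantumFields.BalabanUV.T4Continuum.NE7b.SoftStepBlockingSemigroup
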